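import Summits.AtomisticToContinuum.HydrodynamicLimit.Theorems.CollisionIsometryCLTMacroClosureStubThermoEos

/-!
# Stub `stub_thermo` of the line `IdeatorTwoGen1Sketch` (crux `MacroClosure`, stmt-14870) —
# part 3b: the hs-Euler fluxes and their Jacobians at a physical state

Support file (registered sub-goal `stub_thermo_fluxDeriv`) for the stub
`Barycentric.stub_thermo : ∃ η₃, 0 < η₃ ∧ ThermoChamber η₃`.

At `U = stateOf ρ u θ` in the dilute chamber (`ρ, θ > 0`, `ρσ³ < η₀`), with
`Z = hsCompressibility (ρσ³)`, `Z′ = deriv hsCompressibility (ρσ³)`, `p = ρθZ`: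
* `eulerFlux_stateOf` — `F_j(U) = (ρu_j, (ρu_j) u + p e_j, (E + p) u_j)`;
* `fderiv_eulerFlux_apply` — the flux Jacobian applied to `V`:
  `DF_j(U)V = (V.m_j, (V.m_j − u_jV.ρ) u + u_j V.m + δp e_j, (V.E + δp) u_j + H (V.m_j − u_jV.ρ))`
  with `δp = V.ρ θZ + ρZ δθ + ρθσ³Z′ V.ρ`, `δθ = (2V.E − 2⟪u,V.m⟫ + (|u|² − 3θ)V.ρ)/(3ρ)`,
  `H = |u|²/2 + 3θ/2 + θZ` (line derivative + uniqueness, as for the entropy in part 1);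
* `deriv_hsCompressibility_eq` — `Z′(x) = F′(x) + xF″(x)` on `(0, η₀)`;
* `inner_fin3` — coordinates of the inner product of `V3`.
-/

noncomputable section

open MeasureTheory Filter Set Topology InformationTheory
open scoped ENNReal ContDiff

namespace Summit.AtomisticToContinuum.HydrodynamicLimit.Theorems.MacroClosureLine

open Literature.MathematicalPhysics.KineticTheory Literature.Analysis.FluidPDE
open Literature.Analysis.FunctionSpaces

namespace Barycentric

variable {η₀ : ℝ} {F : ℝ → ℝ}

/-! ## Small algebraic helpers -/

/-- The inner product of `V3 = ℝ³` in coordinates. -/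
theorem inner_fin3 (a b : V3) : inner ℝ a b = a 0 * b 0 + a 1 * b 1 + a 2 * b 2 := by
  simp [PiLp.inner_apply, Fin.sum_univ_three, mul_comm]

/-- Coordinates of the basis vector `e_j`: `⟪a, e_j⟫ = a j`. -/
theorem inner_single_one_right (a : V3) (j : Fin 3) :
    inner ℝ a (EuclideanSpace.single j (1 : ℝ)) = a j := by
  rw [EuclideanSpace.inner_single_right]
  simp

/-- Coordinates of the basis vector `e_j`: `⟪e_j, a⟫ = a j`. -/
theorem inner_single_one_left (a : V3) (j : Fin 3) :
    inner ℝ (EuclideanSpace.single j (1 : ℝ)) a = a j := by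
  rw [real_inner_comm, inner_single_one_right]

/-! ## The compressibility factor on `(0, η₀)` -/

/-- `Z` is differentiable on `(0, η₀)` with `Z′(x) = F′(x) + x F″(x)`. -/
theorem hasDerivAt_hsCompressibility (hFa : AnalyticOnNhd ℝ F (Ioo (-η₀) η₀))
    (hF : EqOn hsExcessFreeEnergy F (Ico 0 η₀)) {x : ℝ} (hx : x ∈ Ioo 0 η₀) :
    HasDerivAt hsCompressibility (deriv F x + x * deriv (deriv F) x) x := by
  have hmem : x ∈ Ioo (-η₀) η₀ := ⟨by linarith [hx.1, hx.2], hx.2⟩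
  have hF' : HasDerivAt (deriv F) (deriv (deriv F) x) x :=
    (hFa.deriv x hmem).differentiableAt.hasDerivAt
  have h : HasDerivAt (fun y => 1 + y * deriv F y)
      (0 + (1 * deriv F x + x * deriv (deriv F) x)) x :=
    (hasDerivAt_const x (1 : ℝ)).add ((hasDerivAt_id x).mul hF')
  refine (h.congr_of_eventuallyEq ?_).congr_deriv (by ring)
  filter_upwards [isOpen_Ioo.mem_nhds hx] with y hy
  exact hsCompressibility_eq hF hy

/-- `deriv Z x = F′(x) + x F″(x)` on `(0, η₀)`. -/
theorem deriv_hsCompressibility_eq (hFa : AnalyticOnNhd ℝ F (Ioo (-η₀) η₀))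
    (hF : EqOn hsExcessFreeEnergy F (Ico 0 η₀)) {x : ℝ} (hx : x ∈ Ioo 0 η₀) :
    deriv hsCompressibility x = deriv F x + x * deriv (deriv F) x :=
  (hasDerivAt_hsCompressibility hFa hF hx).deriv

/-- The derivative of the rescaled law `ζ(r) = Z(rσ³)`: `ζ′(ρ) = σ³ Z′(ρσ³)`. -/
theorem deriv_hsCompressibility_rescale (hFa : AnalyticOnNhd ℝ F (Ioo (-η₀) η₀))
    (hF : EqOn hsExcessFreeEnergy F (Ico 0 η₀)) {σ ρ : ℝ} (hx : ρ * σ ^ 3 ∈ Ioo 0 η₀) :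
    deriv (fun r => hsCompressibility (r * σ ^ 3)) ρ =
      σ ^ 3 * deriv hsCompressibility (ρ * σ ^ 3) := by
  have hlin : HasDerivAt (fun r : ℝ => r * σ ^ 3) (1 * σ ^ 3) ρ := (hasDerivAt_id ρ).mul_const _
  have h := ((hasDerivAt_hsCompressibility hFa hF hx).comp ρ hlin).deriv
  rw [deriv_hsCompressibility_eq hFa hF hx]
  rw [show (fun r => hsCompressibility (r * σ ^ 3)) = hsCompressibility ∘ fun r => r * σ ^ 3
    from rfl, h]
  ring

/-! ## The fluxes at a physical state -/

/-- **The hs-Euler flux at `stateOf ρ u θ`**: `F_j = (ρu_j, (ρu_j) u + p e_j, (E + p) u_j)`,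
`p = ρ θ Z(ρσ³)`. -/
theorem eulerFlux_stateOf (σ : ℝ) {ρ : ℝ} (hρ : ρ ≠ 0) (u : V3) (θ : ℝ) (j : Fin 3) :
    eulerFlux σ j (stateOf ρ u θ) =
      (ρ * u j, (ρ * u j) • u + (ρ * θ * hsCompressibility (ρ * σ ^ 3)) •
          EuclideanSpace.single j (1 : ℝ),
        (ρ * (‖u‖ ^ 2 / 2 + 3 / 2 * θ) + ρ * θ * hsCompressibility (ρ * σ ^ 3)) * u j) := by
  have hT := stateTemp_stateOf hρ u θ
  unfold eulerFlux hsPressure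
  rw [hT]
  simp only [stateOf_fst, stateOf_snd_fst, stateOf_snd_snd, PiLp.smul_apply, smul_eq_mul]
  refine Prod.ext rfl (Prod.ext ?_ ?_)
  · simp only
    rw [smul_smul]
    congr 1
    field_simp
  · simp only
    field_simp

/-- The derivative of the flux along the line `t ↦ stateOf ρ u θ + t • V` at `t = 0`. -/
theorem hasDerivAt_eulerFlux_line (hFa : AnalyticOnNhd ℝ F (Ioo (-η₀) η₀))
    (hF : EqOn hsExcessFreeEnergy F (Ico 0 η₀)) {σ ρ θ : ℝ} (u : V3) (hσ : 0 < σ) (hρ : 0 < ρ)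
    (hx : ρ * σ ^ 3 < η₀) (j : Fin 3) (V : State) :
    HasDerivAt (fun t : ℝ => eulerFlux σ j (stateOf ρ u θ + t • V))
      (V.2.1 j,
        (V.2.1 j - u j * V.1) • u + u j • V.2.1 +
          (V.1 * θ * hsCompressibility (ρ * σ ^ 3) +
              ρ * hsCompressibility (ρ * σ ^ 3) *
                ((2 * V.2.2 - 2 * inner ℝ u V.2.1 + (‖u‖ ^ 2 - 3 * θ) * V.1) / (3 * ρ)) +
              ρ * θ * σ ^ 3 * deriv hsCompressibility (ρ * σ ^ 3) * V.1) •
            EuclideanSpace.single j (1 : ℝ),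
        (V.2.2 + (V.1 * θ * hsCompressibility (ρ * σ ^ 3) +
              ρ * hsCompressibility (ρ * σ ^ 3) *
                ((2 * V.2.2 - 2 * inner ℝ u V.2.1 + (‖u‖ ^ 2 - 3 * θ) * V.1) / (3 * ρ)) +
              ρ * θ * σ ^ 3 * deriv hsCompressibility (ρ * σ ^ 3) * V.1)) * u j +
          (‖u‖ ^ 2 / 2 + 3 / 2 * θ + θ * hsCompressibility (ρ * σ ^ 3)) *
            (V.2.1 j - u j * V.1)) 0 := by
  set e₁ : V3 := EuclideanSpace.single j (1 : ℝ) with he₁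
  set a : ℝ → ℝ := fun t => ρ + t * V.1 with ha_def
  set mv : ℝ → V3 := fun t => ρ • u + t • V.2.1 with hmv_def
  set mj : ℝ → ℝ := fun t => ρ * u j + t * V.2.1 j with hmj_def
  set en : ℝ → ℝ := fun t => ρ * (‖u‖ ^ 2 / 2 + 3 / 2 * θ) + t * V.2.2 with hen_def
  set q : ℝ → ℝ := fun t => ‖ρ • u + t • V.2.1‖ ^ 2 with hq_def
  set Th : ℝ → ℝ := fun t => 2 / 3 * (en t / a t - q t / (2 * a t ^ 2)) with hTh_def
  set P : ℝ → ℝ := fun t => a t * Th t * hsCompressibility (a t * σ ^ 3) with hP_def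
  have hfun : (fun t : ℝ => eulerFlux σ j (stateOf ρ u θ + t • V)) = fun t =>
      (mj t, (mj t / a t) • mv t + P t • e₁, (en t + P t) * mj t / a t) := by
    funext t
    simp [eulerFlux, stateOf, totalEnergyDensity, hsPressure, stateTemp, a, mv, mj, en, q, Th, P,
      e₁]
  rw [hfun]
  -- the elementary derivatives
  have ha : HasDerivAt a V.1 0 := by
    simpa [a] using ((hasDerivAt_id (0 : ℝ)).mul_const V.1).const_add ρ
  have hmv : HasDerivAt mv V.2.1 0 := by
    simpa [mv] using ((hasDerivAt_id (0 : ℝ)).smul_const V.2.1).const_add (ρ • u)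
  have hmj : HasDerivAt mj (V.2.1 j) 0 := by
    simpa [mj] using ((hasDerivAt_id (0 : ℝ)).mul_const (V.2.1 j)).const_add (ρ * u j)
  have hen : HasDerivAt en V.2.2 0 := by
    simpa [en] using ((hasDerivAt_id (0 : ℝ)).mul_const V.2.2).const_add
      (ρ * (‖u‖ ^ 2 / 2 + 3 / 2 * θ))
  have hq : HasDerivAt q (2 * inner ℝ (ρ • u) V.2.1) 0 := by
    have hl : HasDerivAt (fun s : ℝ => ρ • u + s • V.2.1) V.2.1 0 := by
      simpa using ((hasDerivAt_id (0 : ℝ)).smul_const V.2.1).const_add (ρ • u)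
    simpa [q] using hl.norm_sq
  have ha0 : a 0 = ρ := by simp [a]
  have hmv0 : mv 0 = ρ • u := by simp [mv]
  have hmj0 : mj 0 = ρ * u j := by simp [mj]
  have hen0 : en 0 = ρ * (‖u‖ ^ 2 / 2 + 3 / 2 * θ) := by simp [en]
  have hq0 : q 0 = ρ ^ 2 * ‖u‖ ^ 2 := by simp [q, norm_smul, mul_pow]
  have hρ0 : a 0 ≠ 0 := by rw [ha0]; exact hρ.ne'
  have h2a : 2 * a 0 ^ 2 ≠ 0 := by rw [ha0]; positivity
  have hTh : HasDerivAt Th (2 / 3 * ((V.2.2 * a 0 - en 0 * V.1) / a 0 ^ 2 -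
      (2 * inner ℝ (ρ • u) V.2.1 * (2 * a 0 ^ 2) - q 0 * (2 * (2 * a 0 ^ 1 * V.1))) /
        (2 * a 0 ^ 2) ^ 2)) 0 :=
    ((hen.div ha hρ0).sub (hq.div ((ha.pow 2).const_mul 2) h2a)).const_mul (2 / 3)
  have hxI : ρ * σ ^ 3 ∈ Ioo 0 η₀ := ⟨by positivity, hx⟩
  have hZ : HasDerivAt (fun t => hsCompressibility (a t * σ ^ 3))
      ((deriv F (ρ * σ ^ 3) + ρ * σ ^ 3 * deriv (deriv F) (ρ * σ ^ 3)) * (V.1 * σ ^ 3)) 0 :=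
    (hasDerivAt_hsCompressibility hFa hF hxI).comp_of_eq 0 (ha.mul_const (σ ^ 3)) (by rw [ha0])
  have hP : HasDerivAt P _ 0 := (ha.fun_mul hTh).fun_mul hZ
  have hc2 := ((hmj.fun_div ha hρ0).fun_smul hmv).fun_add (hP.smul_const e₁)
  have hc3 := ((hen.fun_add hP).fun_mul hmj).fun_div ha hρ0
  have hall := hmj.prodMk (hc2.prodMk hc3)
  refine hall.congr_deriv ?_
  have hTh0 : Th 0 = θ := by
    simp only [hTh_def, ha0, hen0, hq0]
    field_simp
    ring
  have hZ' : deriv hsCompressibility (ρ * σ ^ 3) =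
      deriv F (ρ * σ ^ 3) + ρ * σ ^ 3 * deriv (deriv F) (ρ * σ ^ 3) :=
    deriv_hsCompressibility_eq hFa hF hxI
  simp only [hP_def, ha0, hmv0, hmj0, hen0, hq0, hTh0, real_inner_smul_left, hZ']
  refine Prod.ext rfl (Prod.ext ?_ ?_)
  · simp only [smul_smul]
    -- compare coefficients of `u`, `V.2.1`, `e₁`
    rw [show ρ * u j / ρ = u j by field_simp]
    match_scalars <;> (field_simp; try ring)
  · field_simp
    ring

/-- **The flux Jacobian at `stateOf ρ u θ`, applied to `V`.** -/
theorem fderiv_eulerFlux_apply (hFa : AnalyticOnNhd ℝ F (Ioo (-η₀) η₀))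
    (hF : EqOn hsExcessFreeEnergy F (Ico 0 η₀)) {σ ρ θ : ℝ} (u : V3) (hσ : 0 < σ) (hρ : 0 < ρ)
    (hθ : 0 < θ) (hx : ρ * σ ^ 3 < η₀) (j : Fin 3) (V : State) :
    fderiv ℝ (eulerFlux σ j) (stateOf ρ u θ) V =
      (V.2.1 j,
        (V.2.1 j - u j * V.1) • u + u j • V.2.1 +
          (V.1 * θ * hsCompressibility (ρ * σ ^ 3) +
              ρ * hsCompressibility (ρ * σ ^ 3) *
                ((2 * V.2.2 - 2 * inner ℝ u V.2.1 + (‖u‖ ^ 2 - 3 * θ) * V.1) / (3 * ρ)) +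
              ρ * θ * σ ^ 3 * deriv hsCompressibility (ρ * σ ^ 3) * V.1) •
            EuclideanSpace.single j (1 : ℝ),
        (V.2.2 + (V.1 * θ * hsCompressibility (ρ * σ ^ 3) +
              ρ * hsCompressibility (ρ * σ ^ 3) *
                ((2 * V.2.2 - 2 * inner ℝ u V.2.1 + (‖u‖ ^ 2 - 3 * θ) * V.1) / (3 * ρ)) +
              ρ * θ * σ ^ 3 * deriv hsCompressibility (ρ * σ ^ 3) * V.1)) * u j +
          (‖u‖ ^ 2 / 2 + 3 / 2 * θ + θ * hsCompressibility (ρ * σ ^ 3)) *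
            (V.2.1 j - u j * V.1)) := by
  have hd : DifferentiableAt ℝ (eulerFlux σ j) (stateOf ρ u θ) :=
    differentiableAt_eulerFlux hFa hF hσ (stateOf_mem_chamber u hρ hθ hx) j
  have hline : HasDerivAt (fun t : ℝ => stateOf ρ u θ + t • V) V 0 := by
    simpa using ((hasDerivAt_id (0 : ℝ)).smul_const V).const_add (stateOf ρ u θ)
  have h1 : HasDerivAt (fun t : ℝ => eulerFlux σ j (stateOf ρ u θ + t • V))
      (fderiv ℝ (eulerFlux σ j) (stateOf ρ u θ) V) 0 :=
    hd.hasFDerivAt.comp_hasDerivAt_of_eq 0 hline (by simp)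
  exact h1.unique (hasDerivAt_eulerFlux_line hFa hF u hσ hρ hx j V)

/-- **Registered sub-goal `stub_thermo_fluxDeriv` of `stub_thermo`**: the hs-Euler flux and its
Jacobian at a physical state of the dilute chamber, in primitive variables. -/
theorem stub_thermo_fluxDeriv : ∀ (η₀ : ℝ) (F : ℝ → ℝ), AnalyticOnNhd ℝ F (Ioo (-η₀) η₀) →
    EqOn hsExcessFreeEnergy F (Ico 0 η₀) → ∀ (σ ρ θ : ℝ) (u : V3), 0 < σ → 0 < ρ → 0 < θ →
    ρ * σ ^ 3 < η₀ → ∀ (j : Fin 3) (V : State),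
    eulerFlux σ j (stateOf ρ u θ) =
      (ρ * u j, (ρ * u j) • u + (ρ * θ * hsCompressibility (ρ * σ ^ 3)) •
          EuclideanSpace.single j (1 : ℝ),
        (ρ * (‖u‖ ^ 2 / 2 + 3 / 2 * θ) + ρ * θ * hsCompressibility (ρ * σ ^ 3)) * u j) ∧
    fderiv ℝ (eulerFlux σ j) (stateOf ρ u θ) V =
      (V.2.1 j,
        (V.2.1 j - u j * V.1) • u + u j • V.2.1 +
          (V.1 * θ * hsCompressibility (ρ * σ ^ 3) +
              ρ * hsCompressibility (ρ * σ ^ 3) *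
                ((2 * V.2.2 - 2 * inner ℝ u V.2.1 + (‖u‖ ^ 2 - 3 * θ) * V.1) / (3 * ρ)) +
              ρ * θ * σ ^ 3 * deriv hsCompressibility (ρ * σ ^ 3) * V.1) •
            EuclideanSpace.single j (1 : ℝ),
        (V.2.2 + (V.1 * θ * hsCompressibility (ρ * σ ^ 3) +
              ρ * hsCompressibility (ρ * σ ^ 3) *
                ((2 * V.2.2 - 2 * inner ℝ u V.2.1 + (‖u‖ ^ 2 - 3 * θ) * V.1) / (3 * ρ)) +
              ρ * θ * σ ^ 3 * deriv hsCompressibility (ρ * σ ^ 3) * V.1)) * u j +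
          (‖u‖ ^ 2 / 2 + 3 / 2 * θ + θ * hsCompressibility (ρ * σ ^ 3)) *
            (V.2.1 j - u j * V.1)) :=
  fun _ _ hFa hF σ _ θ u hσ hρ hθ hx j V =>
    ⟨eulerFlux_stateOf σ hρ.ne' u θ j, fderiv_eulerFlux_apply hFa hF u hσ hρ hθ hx j V⟩

end Barycentric

end Summit.AtomisticToContinuum.HydrodynamicLimit.Theorems.MacroClosureLine

end
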